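import Summits.CriticalPhenomena.PercolationContinuityZ3.Theorems.PercNearOneGluingNoHeavyRsw3InvasionGreedy
import Summits.CriticalPhenomena.PercolationContinuityZ3.Theorems.PercNearOneGluingNoHeavyRsw3InfiniteClusterDensityAS
import Literature.Probability.LatticeModels.LatticeGraph
import HarnessLib

/-!
# RSW3 lane (P2, gen 26): INVASION PERCOLATION VII — THE LAW OF THE LARGEST INVADED LABEL IS `θ`:
# `μ{sup_n x_n ≤ y} = θ(y)` for every `y`; hence `θ(p_c) = 0` ⟺ "a.s. the invasion accepts a label `> p_c`" — on `ℤ^d`, `d ≥ 2`, it does (p205010)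

builds on p205010 (kernel theorem, internal audit signed; external expert review pending) — used only in `ae_exists_criticalProb_lt_acceptedLabel`.

Cell `prim-rsw3`, prover seat `prim-rsw3-p2` (gen 26), memo `run/shared/lean/prim/rsw3/P2-RSWLITE.md` §33.  Support file
(`--supports stmt-CriticalPhenomena-4575`); no definitions, no named facts, no sorries.

A deterministic identity behind Chayes–Chayes–Newman's Theorem 3.1 ("Let `x > p_c`. Then with nonzero probability `Q_n(y) = 1` for all
`n`" — proof: "the event that … the origin is part of an infinite cluster has nonzero probability"):

* **`forall_acceptedLabel_le_iff_infinite_openCluster`** (every infinite connected locally finite graph, every label field, every `y`):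
  ALL accepted labels are `≤ y` IF AND ONLY IF the `y`-open cluster of the root in the coupled configuration `η_y` is infinite
  (⇐ the absorption principle of file I; ⇒ propagation from time `0`: the infinite invaded region lies in `C_y(o)`).
* **`labelMeasure_real_forall_acceptedLabel_le`** (`ℤ^d`, `d ≥ 1`): `μ{U : x_n(U) ≤ y for all n} = θ(y)` — the distribution function of
  the LARGEST invaded label `sup_n x_n` is the percolation probability.
* `ae_exists_lt_acceptedLabel_iff_theta_eq_zero` (`d ≥ 1`): (a.s. some invaded label exceeds `y`) ⟺ `θ(y) = 0`; so continuity of `θ` at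
  `p_c` is EQUIVALENT to "almost surely the invasion accepts a label above `p_c`", and by p205010 (`ae_exists_criticalProb_lt_acceptedLabel`,
  `d ≥ 2`) it does.  (File V has the stronger "infinitely often" by a different route.)

References: J. T. Chayes, L. Chayes, C. M. Newman, Comm. Math. Phys. 101 (1985) 383–407, Thm 3.1 and §3 [ChayesChayesNewman1985].
-/

noncomputable section

namespace Summit.CriticalPhenomena.PercolationContinuityZ3.Theorems.Rsw3

open Finset MeasureTheory ProbabilityTheory Filter Topology Literature.Probability.LatticeModels Literature.Probability.Percolation
open Literature.Probability.Percolation.Invasion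

/-! ## §1 The deterministic identity (every graph) -/

section General

variable {V : Type*} [DecidableEq V] {G : SimpleGraph V} [G.LocallyFinite]

/-- **All accepted labels are `≤ y` iff the root's `y`-cluster is infinite** (infinite preconnected locally finite graph, every label
field, every tie-break). [cite: ChayesChayesNewman1985, Thm 3.1 (proof)] -/
theorem forall_acceptedLabel_le_iff_infinite_openCluster [Infinite V] (hG : G.Preconnected) (U : Sym2 V → ℝ) (o : V) (y : ℝ) :
    (∀ n, acceptedLabel G U o n ≤ y) ↔ (openCluster (configOfLabels y U G) o).Infinite := by
  constructor
  · intro h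
    have hsub : invadedRegion G U o ⊆ openCluster (configOfLabels y U G) o := by
      intro v hv
      obtain ⟨u, hu, huv⟩ := Set.mem_iUnion₂.1
        (invadedRegion_subset_of_forall_acceptedLabel_le (n₀ := 0) (fun n _ => h n) hv)
      have hu' : u = o := by simpa [invasion_zero] using hu
      subst hu'
      exact huv
    exact (invadedRegion_infinite hG U o).mono hsub
  · intro hinf n
    exact acceptedLabel_le_of_infinite_cluster (root_mem_invasion U o n) hinf

/-- Set form: `{U | ∀ n, x_n(U) ≤ y} = η_y⁻¹ {|C(o)| = ∞}`. [cite: ChayesChayesNewman1985, Thm 3.1 (proof)] -/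
theorem setOf_forall_acceptedLabel_le_eq [Infinite V] (hG : G.Preconnected) (o : V) (y : ℝ) :
    {U : Sym2 V → ℝ | ∀ n, acceptedLabel G U o n ≤ y} = (fun U => configOfLabels y U G) ⁻¹' percolatesAt o := by
  ext U
  exact forall_acceptedLabel_le_iff_infinite_openCluster hG U o y

end General

/-! ## §2 `ℤ^d`: the law of the largest invaded label -/

variable {d : ℕ}

/-- **The distribution function of the largest invaded label is `θ`**: `μ{U : x_n(U) ≤ y for all n} = θ(y)` on `ℤ^d`, `d ≥ 1`, for every
`y ∈ [0,1]`. [cite: ChayesChayesNewman1985, Thm 3.1] -/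
theorem labelMeasure_real_forall_acceptedLabel_le (hd : 1 ≤ d) (y : unitInterval) :
    (labelMeasure (Site d)).real {U | ∀ n, acceptedLabel (zdGraph d) U 0 n ≤ y} = theta (zdGraph d) (0 : Site d) y := by
  haveI : Nonempty (Fin d) := ⟨⟨0, hd⟩⟩
  haveI : Infinite (Site d) := Pi.infinite_of_right
  rw [setOf_forall_acceptedLabel_le_eq zdGraph_preconnected_holds 0 (y : ℝ), theta, ← map_configOfLabels_holds (zdGraph d) y,
    measureReal_def, measureReal_def, Measure.map_apply (measurable_configOfLabels _ _) (measurableSet_percolatesAt_holds 0)]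

/-- **(a.s. some invaded label exceeds `y`) ⟺ `θ(y) = 0`** (`ℤ^d`, `d ≥ 1`). [cite: ChayesChayesNewman1985, Thm 3.1] -/
theorem ae_exists_lt_acceptedLabel_iff_theta_eq_zero (hd : 1 ≤ d) (y : unitInterval) :
    (∀ᵐ U ∂(labelMeasure (Site d)), ∃ n, (y : ℝ) < acceptedLabel (zdGraph d) U 0 n) ↔ theta (zdGraph d) (0 : Site d) y = 0 := by
  haveI : IsProbabilityMeasure (labelMeasure (Site d)) := isProbabilityMeasure_labelMeasure _
  haveI : Nonempty (Fin d) := ⟨⟨0, hd⟩⟩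
  haveI : Infinite (Site d) := Pi.infinite_of_right
  have hset : {U : Sym2 (Site d) → ℝ | ¬ ∃ n, (y : ℝ) < acceptedLabel (zdGraph d) U 0 n} =
      {U | ∀ n, acceptedLabel (zdGraph d) U 0 n ≤ y} := by
    ext U; simp only [Set.mem_setOf_eq, not_exists, not_lt]
  rw [ae_iff, hset, ← labelMeasure_real_forall_acceptedLabel_le hd y, measureReal_def,
    ENNReal.toReal_eq_zero_iff]
  simp only [measure_ne_top, or_false]

/-- **On `ℤ^d`, `d ≥ 2`, the invasion almost surely accepts a label strictly above `p_c`** — equivalently `θ(p_c) = 0` (p205010).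
[cite: ChayesChayesNewman1985, Thm 3.1 (contrapositive at p_c)] -/
theorem ae_exists_criticalProb_lt_acceptedLabel (hd : 2 ≤ d) :
    ∀ᵐ U ∂(labelMeasure (Site d)), ∃ n, criticalProb (zdGraph d) (0 : Site d) < acceptedLabel (zdGraph d) U 0 n :=
  (ae_exists_lt_acceptedLabel_iff_theta_eq_zero (by omega) (criticalProbI d)).2 (CSH.percolationContinuity_allDimensions d hd)

end Summit.CriticalPhenomena.PercolationContinuityZ3.Theorems.Rsw3
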